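import Summits.BirchSwinnertonDyer.BirchSwinnertonDyer.Theorems.ByReductionTypeAtTwoAdditivePotMultConjATwoNarrowRoadKitDoors
import HarnessLib

/-!
# C4″ `AdditivePotMultOverKAtTwo` (item stmt-BirchSwinnertonDyer-22618), the (I1M′) input on the `0 < Δ` rows:
# the NARROW-ROAD KIT, part D (REAL ARITHMETIC) — the rational-interval certificates for the sign of `A(x) + C(x)·(±√2)` at a located
# real root `x`, and «three distinct real embeddings of a cubic field are all of them»

Cell `bsd-2adic`, rung K4, seat `bsd-2adic-k4-w3` GEN 12 (explicit unit of director-bsd g16 (309)(7); `--supports stmt-BirchSwinnertonDyer-22618`).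
HONEST FRAMING (D-0036/D-0054/D-0152): THEOREMS ONLY (no definition, no named fact, no `sorry`, no instance). Elementary plumbing for the
per-field narrow certificates (parts A–C: `…NarrowRoadKit`, `…KitSquares`, `…KitDoors`); closes nothing at the `∀`-level; nothing booked; BSD is
not proved by any of this.

WHAT. A unit of `A = ℚ(θ, √2)` is certified as `(a₀ + a₁θ + a₂θ² + (c₀ + c₁θ + c₂θ²)√2)/d`; under a real embedding `σ` with `σθ = x`,
`σ√2 = y = ±√2` its sign is that of `A(x) + C(x)·y`. The generator supplies rational bounds `Alo ≤ A(x)` (or `A(x) ≤ Ahi`) and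
`Clo ≤ C(x)` (or `≤ Chi`) from the tree's endpoint lemma `quadratic_pos_of_endpoints` on the located root, and tight bounds on `√2`
(`sqrt_two_gt_rat`, `sqrt_two_lt_rat`, part A); the four lemmas of §1 turn these into the sign by LINEAR arithmetic (the product `C·y` is
bounded by `Cb·y` and then by `Cb·ylo`, `Cb·yhi`). §2: `neg_sqrt_two` bounds; §3: positivity at every real embedding of a cubic field from
positivity at three distinct ones.

* §1 `lin_pos_of_nonneg_y`, `lin_neg_of_nonneg_y`, `lin_pos_of_nonpos_y`, `lin_neg_of_nonpos_y`.
* §2 `neg_sqrt_two_lt_rat`, `neg_sqrt_two_gt_rat`.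
* §3 `forall_ringHom_pos_of_three`. §4 `embedding_neg_of_scaled_neg`, `forall_embedding_pos_of_scaled` (scaled-value companions of part C).

References: [Cohen1993] §4.1.3 (real roots, signatures, Algorithm 4.1.11); [FrohlichTaylor1990] Ch. V §1 (1.10)–(1.13).
-/

set_option autoImplicit false
-- sibling precedent (`…NarrowRoadKit.lean`): the directory name repeats the summit name
set_option linter.dupNamespace false

noncomputable section

namespace Summit.BirchSwinnertonDyer.BirchSwinnertonDyer.Theorems.AddKatoTwo

open NumberField

/-! ## §1 The sign of `A + C·y` from one-sided rational bounds -/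

/-- **`0 < A + C·y`** for `0 ≤ y ∈ [ylo, yhi]` from `Alo ≤ A`, `Clo ≤ C` and the two corner checks `0 < Alo + Clo·ylo`, `0 < Alo + Clo·yhi`
(`C·y ≥ Clo·y ≥ min(Clo·ylo, Clo·yhi)`). [cite: Cohen1993, §4.1.3 (Algorithm 4.1.11: signs at real places by rational arithmetic)] -/
theorem lin_pos_of_nonneg_y {A C y Alo Clo ylo yhi : ℝ} (hA : Alo ≤ A) (hC : Clo ≤ C) (hy : 0 ≤ y) (hylo : ylo ≤ y) (hyhi : y ≤ yhi)
    (h1 : 0 < Alo + Clo * ylo) (h2 : 0 < Alo + Clo * yhi) : 0 < A + C * y := by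
  have hCy : Clo * y ≤ C * y := mul_le_mul_of_nonneg_right hC hy
  rcases le_or_gt 0 Clo with hc | hc
  · have : Clo * ylo ≤ Clo * y := mul_le_mul_of_nonneg_left hylo hc
    linarith
  · have : Clo * yhi ≤ Clo * y := mul_le_mul_of_nonpos_left hyhi hc.le
    linarith

/-- **`A + C·y < 0`** for `0 ≤ y ∈ [ylo, yhi]` from `A ≤ Ahi`, `C ≤ Chi` and `Ahi + Chi·ylo < 0`, `Ahi + Chi·yhi < 0`.
[cite: Cohen1993, §4.1.3 (Algorithm 4.1.11)] -/
theorem lin_neg_of_nonneg_y {A C y Ahi Chi ylo yhi : ℝ} (hA : A ≤ Ahi) (hC : C ≤ Chi) (hy : 0 ≤ y) (hylo : ylo ≤ y) (hyhi : y ≤ yhi)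
    (h1 : Ahi + Chi * ylo < 0) (h2 : Ahi + Chi * yhi < 0) : A + C * y < 0 := by
  have h := lin_pos_of_nonneg_y (A := -A) (C := -C) (Alo := -Ahi) (Clo := -Chi) (by linarith) (by linarith) hy hylo hyhi
    (by linarith) (by linarith)
  linarith

/-- **`0 < A + C·y`** for `y ≤ 0`, `y ∈ [ylo, yhi]` from `Alo ≤ A`, `C ≤ Chi` and `0 < Alo + Chi·ylo`, `0 < Alo + Chi·yhi`
(`C·y ≥ Chi·y ≥ min(Chi·ylo, Chi·yhi)`). [cite: Cohen1993, §4.1.3 (Algorithm 4.1.11)] -/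
theorem lin_pos_of_nonpos_y {A C y Alo Chi ylo yhi : ℝ} (hA : Alo ≤ A) (hC : C ≤ Chi) (hy : y ≤ 0) (hylo : ylo ≤ y) (hyhi : y ≤ yhi)
    (h1 : 0 < Alo + Chi * ylo) (h2 : 0 < Alo + Chi * yhi) : 0 < A + C * y := by
  have h := lin_pos_of_nonneg_y (A := A) (C := -C) (y := -y) (Alo := Alo) (Clo := -Chi) (ylo := -yhi) (yhi := -ylo)
    hA (by linarith) (by linarith) (by linarith) (by linarith) (by linarith) (by linarith)
  linarith

/-- **`A + C·y < 0`** for `y ≤ 0`, `y ∈ [ylo, yhi]` from `A ≤ Ahi`, `Clo ≤ C` and `Ahi + Clo·ylo < 0`, `Ahi + Clo·yhi < 0`.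
[cite: Cohen1993, §4.1.3 (Algorithm 4.1.11)] -/
theorem lin_neg_of_nonpos_y {A C y Ahi Clo ylo yhi : ℝ} (hA : A ≤ Ahi) (hC : Clo ≤ C) (hy : y ≤ 0) (hylo : ylo ≤ y) (hyhi : y ≤ yhi)
    (h1 : Ahi + Clo * ylo < 0) (h2 : Ahi + Clo * yhi < 0) : A + C * y < 0 := by
  have h := lin_pos_of_nonpos_y (A := -A) (C := -C) (Alo := -Ahi) (Chi := -Clo) (by linarith) (by linarith) hy hylo hyhi
    (by linarith) (by linarith)
  linarith

/-! ## §2 Bounds for `−√2` -/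

/-- `−1.4142135623730950489 < −√2`. [folklore] -/
theorem neg_sqrt_two_gt_rat : (-(14142135623730950489 / 10000000000000000000) : ℝ) < -Real.sqrt 2 := by
  have := sqrt_two_lt_rat; linarith

/-- `−√2 < −1.4142135623730950488`. [folklore] -/
theorem neg_sqrt_two_lt_rat : -Real.sqrt 2 < (-(14142135623730950488 / 10000000000000000000) : ℝ) := by
  have := sqrt_two_gt_rat; linarith

/-! ## §3 Three distinct real embeddings of a cubic field are all of them -/

/-- **Positivity at every real embedding of a cubic field from positivity at three distinct ones** (`r₁ ≤ 3`: the three are all).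
[cite: FrohlichTaylor1990, Ch. V §1 (1.14), p. 164] [cite: Cohen1993, §4.1.3 (Def. 4.1.9)] -/
theorem forall_ringHom_pos_of_three {K : Type} [Field K] [NumberField K] (h3 : Module.finrank ℚ K = 3)
    {ρ₀ ρ₁ ρ₂ : K →+* ℝ} (h01 : ρ₀ ≠ ρ₁) (h02 : ρ₀ ≠ ρ₂) (h12 : ρ₁ ≠ ρ₂) (v : K)
    (h0 : 0 < ρ₀ v) (h1 : 0 < ρ₁ v) (h2 : 0 < ρ₂ v) : ∀ σ : K →+* ℝ, 0 < σ v := by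
  classical
  have hinj : Function.Injective ![ρ₀, ρ₁, ρ₂] := by
    intro a c hac
    fin_cases a <;> fin_cases c <;> simp_all
  have hcardK : Fintype.card (K →+* ℝ) = 3 := Literature.NumberTheory.NumberFields.card_ringHom_real_eq_three h3 _ hinj
  have huniv : (Finset.univ : Finset (K →+* ℝ)) = {ρ₀, ρ₁, ρ₂} := by
    symm
    apply Finset.eq_of_subset_of_card_le (Finset.subset_univ _)
    rw [Finset.card_univ, hcardK, Finset.card_insert_of_notMem, Finset.card_pair h12]
    simp only [Finset.mem_insert, Finset.mem_singleton, not_or]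
    exact ⟨h01, h02⟩
  intro σ
  have hσ : σ ∈ ({ρ₀, ρ₁, ρ₂} : Finset (K →+* ℝ)) := huniv ▸ Finset.mem_univ σ
  simp only [Finset.mem_insert, Finset.mem_singleton] at hσ
  rcases hσ with rfl | rfl | rfl
  · exact h0
  · exact h1
  · exact h2

/-! ## §4 Scaled values: negativity -/

/-- `σ e < 0` from a scaled value: `d·e = v`, `σ v < 0`, `0 < d` (companion of part C's `embedding_pos_of_scaled_pos`). [folklore] -/
theorem embedding_neg_of_scaled_neg {K : Type} [Field K] (σ : K →+* ℝ) (e : (𝓞 K)ˣ) {d : ℕ} (hd : 0 < d) {v : K}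
    (he : (d : K) * ((e : 𝓞 K) : K) = v) (hneg : σ v < 0) : σ ((e : 𝓞 K) : K) < 0 := by
  rw [← he, map_mul, map_natCast] at hneg
  have hd' : (0 : ℝ) < d := by exact_mod_cast hd
  by_contra hle
  push Not at hle
  nlinarith

/-- `0 < σ e` for EVERY real embedding from a scaled value `d·e = v` positive at every embedding. [folklore] -/
theorem forall_embedding_pos_of_scaled {K : Type} [Field K] (e : (𝓞 K)ˣ) {d : ℕ} (hd : 0 < d) {v : K}
    (he : (d : K) * ((e : 𝓞 K) : K) = v) (hpos : ∀ σ : K →+* ℝ, 0 < σ v) : ∀ σ : K →+* ℝ, 0 < σ ((e : 𝓞 K) : K) :=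
  fun σ => embedding_pos_of_scaled_pos σ e hd he (hpos σ)

end Summit.BirchSwinnertonDyer.BirchSwinnertonDyer.Theorems.AddKatoTwo

end
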